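import Summits.RiemannHypothesis.RiemannHypothesis.Theorems.Splittings.SplitXWucK1RE
import HarnessLib

/-!
# Splittings — x-wuc GEN-11 `SplitXWucK1R` (K1′(ℝ) AT THE STAKE) — mechanical carve part 6/14
Continuation of `Summits.RiemannHypothesis.RiemannHypothesis.Theorems.Splittings.SplitXWucK1RE`: byte-identical declaration units of the referee-passed extract `SplitXWucK1R.lean`
sha16 70c8eb2af2868881 (x-wuc g11; ref g10 PASS 2026-08-27T22:59:46Z; RULING #330); open namespaces/sections re-opened with their context.
HONEST LABEL: splitting search over kernel-typed RH-equivalences; K-CERT′ (complex `f`) stays OPEN; nothing here bears on the truth of RH.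
-/
set_option linter.dupNamespace false
noncomputable section
open scoped Classical ComplexConjugate
open Set Filter Topology Complex MeasureTheory
open Real Set Filter Topology
open Real Set MeasureTheory Complex Filter Topology
open scoped Real
namespace Summit.RiemannHypothesis.RiemannHypothesis.Theorems.Splittings.XWucG8.DSLine
open scoped ComplexConjugate
section windows
/-- **per-lobe level bound:** the 16-level certificate centred at a maximiser `c` lies below `‖tfT g · κ‖²`. -/
theorem lobe_levels (g : ℝ → ℂ) (hg : Continuous g) {c M : ℝ} (hM : 0 < M)
    (hmax : ∀ y : ℝ, ‖tfT g y 0‖ ≤ M) (hat : ‖tfT g c 0‖ = M) {lam κ : ℝ} (hκ0 : 0 ≤ κ) (hκ : κ ≤ 1 / 2) :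
    (∑ j ∈ (Finset.range 16).filter (fun j => c - (π / 2 - yN j) < lam ∧ lam ≤ c + (π / 2 - yN j)),
      M ^ 2 * (sN j ^ 2 - sN (j + 1) ^ 2)) ≤ ‖tfT g lam κ‖ ^ 2 := by
  have hsum := level_sum_le (k := 16) (fun j => M ^ 2 * sN j ^ 2)
    (fun j => by
      have h1 := sN_succ_le j
      have h2 := sN_nonneg (j + 1)
      have : sN (j + 1) ^ 2 ≤ sN j ^ 2 := pow_le_pow_left₀ h2 h1 2
      exact mul_le_mul_of_nonneg_left this (sq_nonneg M))
    (fun j => by positivity)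
    ((Finset.range 16).filter (fun j => c - (π / 2 - yN j) < lam ∧ lam ≤ c + (π / 2 - yN j)))
    (Finset.filter_subset _ _) (P := ‖tfT g lam κ‖ ^ 2) (by positivity) ?_
  · calc (∑ j ∈ (Finset.range 16).filter (fun j => c - (π / 2 - yN j) < lam ∧ lam ≤ c + (π / 2 - yN j)),
          M ^ 2 * (sN j ^ 2 - sN (j + 1) ^ 2))
        = ∑ j ∈ (Finset.range 16).filter (fun j => c - (π / 2 - yN j) < lam ∧ lam ≤ c + (π / 2 - yN j)),
          (M ^ 2 * sN j ^ 2 - M ^ 2 * sN (j + 1) ^ 2) := by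
          apply Finset.sum_congr rfl; intro j _; ring
      _ ≤ ‖tfT g lam κ‖ ^ 2 := hsum
  · intro j hj
    rw [Finset.mem_filter] at hj
    obtain ⟨hjk, h1, h2⟩ := hj
    have hj16 := Finset.mem_range.mp hjk
    obtain ⟨hy1, hy2⟩ := yN_mem j hj16
    have hπ := Real.pi_gt_d6
    have ht : |lam - c| ≤ π / 2 - yN j := abs_le.mpr ⟨by linarith, by linarith⟩
    have htπ : |lam - c| ≤ π := by linarith
    have hprof := lobe_profile g hg hM hmax hat hκ0 hκ htπ
    rw [show c + (lam - c) = lam by ring] at hprof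
    have hcos : yN j - yN j ^ 3 / 6 ≤ Real.cos (lam - c) := by
      rw [← Real.cos_abs]
      have h3 : Real.cos (π / 2 - yN j) ≤ Real.cos |lam - c| :=
        Real.cos_le_cos_of_nonneg_of_le_pi (abs_nonneg _) (by linarith) ht
      rw [Real.cos_pi_div_two_sub] at h3
      have h4 := Real.sin_gt_sub_cube (show 0 < yN j by linarith)
      linarith
    obtain ⟨hs0, hs⟩ := sN_cert j hj16
    have hD := D_bounds.2
    have h5 : sN j ≤ 25 / 24 * Real.cos (lam - c) - (Real.cosh (1 / 2) - 25 / 24) := by linarith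
    have h6 : M * sN j ≤ ‖tfT g lam κ‖ := le_trans (mul_le_mul_of_nonneg_left h5 hM.le) hprof
    have h7 : 0 ≤ M * sN j := by positivity
    show M ^ 2 * sN j ^ 2 ≤ ‖tfT g lam κ‖ ^ 2
    calc M ^ 2 * sN j ^ 2 = (M * sN j) ^ 2 := by ring
      _ ≤ ‖tfT g lam κ‖ ^ 2 := pow_le_pow_left₀ h7 h6 2

/-- the two-lobe window family (centres `c` and `−c`), as `Fin (16 + 16)`-indexed data. -/
noncomputable def aW (c : ℝ) : Fin (16 + 16) → ℝ :=
  Fin.append (fun j : Fin 16 => c - (π / 2 - yN j)) (fun j : Fin 16 => -c - (π / 2 - yN j))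

/-- `bW` — helper of the x-wuc GEN-11 chain «K1′(ℝ) at the stake» (verbatim from the referee-passed extract `SplitXWucK1R.lean` 70c8eb2af2868881; role: see the module docstring). -/
noncomputable def bW (c : ℝ) : Fin (16 + 16) → ℝ :=
  Fin.append (fun j : Fin 16 => c + (π / 2 - yN j)) (fun j : Fin 16 => -c + (π / 2 - yN j))

/-- `tW` — helper of the x-wuc GEN-11 chain «K1′(ℝ) at the stake» (verbatim from the referee-passed extract `SplitXWucK1R.lean` 70c8eb2af2868881; role: see the module docstring). -/
noncomputable def tW (M : ℝ) : Fin (16 + 16) → ℝ :=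
  Fin.append (fun j : Fin 16 => M ^ 2 * (sN j ^ 2 - sN (j + 1) ^ 2))
    (fun j : Fin 16 => M ^ 2 * (sN j ^ 2 - sN (j + 1) ^ 2))

end windows
section assembly
/-- the in-band class `S_α`: real test functions whose odd part's transform attains its sup modulus inside the band
`|λ| ≤ e^{2π}/4 − 3/2`. -/
def SAlpha : Set (ℝ → ℂ) :=
  {f | (∀ u : ℝ, (f u).im = 0) ∧ ∃ lamS : ℝ, |lamS| ≤ Real.exp (2 * Real.pi) / 4 - 3 / 2 ∧
    ∀ lam : ℝ, ‖tfT (oddPart f) lam 0‖ ≤ ‖tfT (oddPart f) lamS 0‖}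

/-- a maximiser of an odd real transform sits at `|λ*| > 1.35` (the lobe at `λ*` must vanish at `0`). -/
theorem maximiser_far (g : ℝ → ℂ) (hg : Continuous g) {lamS M : ℝ} (hM : 0 < M)
    (hmax : ∀ y : ℝ, ‖tfT g y 0‖ ≤ M) (hat : ‖tfT g lamS 0‖ = M) (h0 : tfT g 0 0 = 0) :
    27 / 20 < |lamS| := by
  by_contra hle'
  have hle : |lamS| ≤ 27 / 20 := not_lt.mp hle'
  have hπ : |(-lamS)| ≤ π := by rw [abs_neg]; linarith [Real.pi_gt_three]
  have h := lobe_profile g hg hM hmax hat (le_refl 0) (by norm_num) hπ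
  rw [add_neg_cancel, h0, norm_zero, Real.cos_neg] at h
  have hX : 25 / 24 * Real.cos lamS - (Real.cosh (1 / 2) - 25 / 24) ≤ 0 := by
    by_contra hX'
    have hX := not_le.mp hX'
    have := mul_pos hM hX
    linarith
  have hcos2 : 1 - |lamS| ^ 2 / 2 ≤ Real.cos lamS := by
    rw [← Real.cos_abs]; exact Real.one_sub_sq_div_two_le_cos
  have h3 : |lamS| ^ 2 ≤ (27 / 20) ^ 2 := pow_le_pow_left₀ (abs_nonneg _) hle 2
  linarith [D_bounds.2]

set_option maxHeartbeats 1600000 in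
/-- **THE (α₁) RUNG (blueprint step (5)).** `KCertLOn S_α 400 (3/2) (43/1000)` — `θ = 0.043 ≥ 0.02788·(3/2)`. -/
theorem kCertLOn_sAlpha : KCertLOn SAlpha 400 (3 / 2) (43 / 1000) := by
  intro ε hε κ₀ hκ₀ hκ₀' f hf hfc
  obtain ⟨hreal, lamS, hlamS, hmaxS⟩ := hf
  have hgc : Continuous (oddPart f) := continuous_oddPart hfc
  have hM0 : 0 ≤ ‖tfT (oddPart f) lamS 0‖ := norm_nonneg _
  have hpair : ‖∫ u in Icc (-1 : ℝ) 1, 2 * (Real.sinh (κ₀ * u) : ℂ) * f u‖ ≤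
      2 * ‖tfT (oddPart f) lamS 0‖ * Real.sinh κ₀ := by
    rw [pairing_oddPart hfc]
    exact norm_pairing_le (oddPart f) hgc _ hmaxS hκ₀.le
  have hΛ := SignConeRung.three_le_Lambda
  have hπlo := Real.pi_gt_d6
  have hπhi := Real.pi_lt_d6
  rcases eq_or_lt_of_le hM0 with hMz | hMpos
  · -- the odd part has identically vanishing transform: empty certificate
    refine ⟨0, Fin.elim0, Fin.elim0, Fin.elim0, fun i => i.elim0, fun lam κ _ _ => by simp, ?_⟩
    have hX : ‖∫ u in Icc (-1 : ℝ) 1, 2 * (Real.sinh (κ₀ * u) : ℂ) * f u‖ = 0 := by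
      apply le_antisymm _ (norm_nonneg _)
      calc ‖∫ u in Icc (-1 : ℝ) 1, 2 * (Real.sinh (κ₀ * u) : ℂ) * f u‖
          ≤ 2 * ‖tfT (oddPart f) lamS 0‖ * Real.sinh κ₀ := hpair
        _ = 0 := by rw [← hMz]; ring
    rw [hX]
    simp
  · set M := ‖tfT (oddPart f) lamS 0‖ with hM_def
    have hatS : ‖tfT (oddPart f) lamS 0‖ = M := rfl
    have hatS' : ‖tfT (oddPart f) (-lamS) 0‖ = M := norm_tfT_oddPart_neg hreal lamS 0
    have hfar := maximiser_far (oddPart f) hgc hMpos hmaxS hatS (tfT_oddPart_zero f)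
    -- geometry of the two lobes: no window straddles 0 and the two lobes are never active together
    have hgeo : ∀ j : ℕ, j < 16 → ∀ c : ℝ, 27 / 20 < |c| →
        ¬ (c - (π / 2 - yN j) < 0 ∧ 0 ≤ c + (π / 2 - yN j)) := by
      intro j hj c hc ⟨h1, h2⟩
      obtain ⟨hy1, hy2⟩ := yN_mem j hj
      have : |c| ≤ π / 2 - yN j := abs_le.mpr ⟨by linarith, by linarith⟩
      linarith
    have hfar' : 27 / 20 < |(-lamS)| := by rwa [abs_neg]
    refine ⟨16 + 16, aW lamS, bW lamS, tW M, ?_, ?_, ?_⟩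
    · -- window data are admissible
      intro i
      induction i using Fin.addCases with
      | left j =>
          simp only [aW, bW, tW, Fin.append_left]
          obtain ⟨hy1, hy2⟩ := yN_mem j j.isLt
          have habs := abs_le.mp hlamS
          have ht : 0 ≤ M ^ 2 * (sN (j : ℕ) ^ 2 - sN ((j : ℕ) + 1) ^ 2) := by
            have h1 := sN_succ_le j
            have h2 := sN_nonneg ((j : ℕ) + 1)
            have : sN ((j : ℕ) + 1) ^ 2 ≤ sN (j : ℕ) ^ 2 := pow_le_pow_left₀ h2 h1 2
            exact mul_nonneg (sq_nonneg M) (by linarith)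
          exact ⟨by linarith, by linarith, by linarith, by linarith, ht⟩
      | right j =>
          simp only [aW, bW, tW, Fin.append_right]
          obtain ⟨hy1, hy2⟩ := yN_mem j j.isLt
          have habs := abs_le.mp hlamS
          have ht : 0 ≤ M ^ 2 * (sN (j : ℕ) ^ 2 - sN ((j : ℕ) + 1) ^ 2) := by
            have h1 := sN_succ_le j
            have h2 := sN_nonneg ((j : ℕ) + 1)
            have : sN ((j : ℕ) + 1) ^ 2 ≤ sN (j : ℕ) ^ 2 := pow_le_pow_left₀ h2 h1 2
            exact mul_nonneg (sq_nonneg M) (by linarith)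
          exact ⟨by linarith, by linarith, by linarith, by linarith, ht⟩
    · -- the certificate lies below ‖tfT f‖²
      intro lam κ hκ hκ'
      have hdom : ‖tfT (oddPart f) lam κ‖ ^ 2 ≤ ‖tfT f lam κ‖ ^ 2 :=
        pow_le_pow_left₀ (norm_nonneg _) (norm_tfT_oddPart_le hreal hfc lam κ) 2
      have hA := lobe_levels (oddPart f) hgc hMpos hmaxS hatS (lam := lam) hκ hκ'.le
      have hB := lobe_levels (oddPart f) hgc hMpos hmaxS hatS' (lam := lam) hκ hκ'.le
      rw [Finset.sum_filter, Fin.sum_univ_add]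
      simp only [aW, bW, tW, Fin.append_left, Fin.append_right]
      rw [Fin.sum_univ_eq_sum_range (fun j => if lamS - (π / 2 - yN j) < lam ∧ lam ≤ lamS + (π / 2 - yN j)
            then M ^ 2 * (sN j ^ 2 - sN (j + 1) ^ 2) else 0) 16,
          Fin.sum_univ_eq_sum_range (fun j => if -lamS - (π / 2 - yN j) < lam ∧ lam ≤ -lamS + (π / 2 - yN j)
            then M ^ 2 * (sN j ^ 2 - sN (j + 1) ^ 2) else 0) 16]
      rw [Finset.sum_filter] at hA hB
      by_cases hact : ∃ j, j < 16 ∧ (lamS - (π / 2 - yN j) < lam ∧ lam ≤ lamS + (π / 2 - yN j))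
      · -- lobe at lamS active ⇒ lobe at −lamS silent
        obtain ⟨j₁, hj₁, hc1, hc2⟩ := hact
        obtain ⟨hy1, hy2⟩ := yN_mem j₁ hj₁
        have hBz : (∑ j ∈ Finset.range 16, if -lamS - (π / 2 - yN j) < lam ∧ lam ≤ -lamS + (π / 2 - yN j)
            then M ^ 2 * (sN j ^ 2 - sN (j + 1) ^ 2) else 0) = 0 := by
          apply Finset.sum_eq_zero
          intro j hj
          rw [if_neg]
          rintro ⟨h1, h2⟩
          obtain ⟨hy1', hy2'⟩ := yN_mem j (Finset.mem_range.mp hj)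
          have : |lamS| ≤ 27 / 20 := abs_le.mpr ⟨by linarith, by linarith⟩
          linarith
        rw [hBz, add_zero]
        exact hA.trans hdom
      · have hAz : (∑ j ∈ Finset.range 16, if lamS - (π / 2 - yN j) < lam ∧ lam ≤ lamS + (π / 2 - yN j)
            then M ^ 2 * (sN j ^ 2 - sN (j + 1) ^ 2) else 0) = 0 := by
          apply Finset.sum_eq_zero
          intro j hj
          rw [if_neg]
          intro h
          exact hact ⟨j, Finset.mem_range.mp hj, h⟩
        rw [hAz, zero_add]
        exact hB.trans hdom
    · -- the credit inequality
      rw [Fin.sum_univ_add]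
      simp only [aW, bW, tW, Fin.append_left, Fin.append_right]
      rw [Fin.sum_univ_eq_sum_range (fun j => M ^ 2 * (sN j ^ 2 - sN (j + 1) ^ 2) *
            (lamS + (π / 2 - yN j) - (lamS - (π / 2 - yN j)) - 3 / 2 -
              if lamS - (π / 2 - yN j) < 0 ∧ 0 ≤ lamS + (π / 2 - yN j) then 3 / 2 else 0)) 16,
          Fin.sum_univ_eq_sum_range (fun j => M ^ 2 * (sN j ^ 2 - sN (j + 1) ^ 2) *
            (-lamS + (π / 2 - yN j) - (-lamS - (π / 2 - yN j)) - 3 / 2 -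
              if -lamS - (π / 2 - yN j) < 0 ∧ 0 ≤ -lamS + (π / 2 - yN j) then 3 / 2 else 0)) 16]
      have hcredA : M ^ 2 * (571 / 2500) ≤ ∑ j ∈ Finset.range 16, M ^ 2 * (sN j ^ 2 - sN (j + 1) ^ 2) *
            (lamS + (π / 2 - yN j) - (lamS - (π / 2 - yN j)) - 3 / 2 -
              if lamS - (π / 2 - yN j) < 0 ∧ 0 ≤ lamS + (π / 2 - yN j) then 3 / 2 else 0) := by
        have h := credit16
        calc M ^ 2 * (571 / 2500) ≤ M ^ 2 * ∑ j ∈ Finset.range 16,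
              (sN j ^ 2 - sN (j + 1) ^ 2) * (1641592 / 1000000 - 2 * yN j) :=
              mul_le_mul_of_nonneg_left h (sq_nonneg M)
          _ = ∑ j ∈ Finset.range 16, M ^ 2 * ((sN j ^ 2 - sN (j + 1) ^ 2) * (1641592 / 1000000 - 2 * yN j)) := by
              rw [Finset.mul_sum]
          _ ≤ _ := by
              apply Finset.sum_le_sum
              intro j hj
              have hj16 := Finset.mem_range.mp hj
              rw [if_neg (hgeo j hj16 lamS hfar)]
              have ht : 0 ≤ sN j ^ 2 - sN (j + 1) ^ 2 := by
                have h1 := sN_succ_le j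
                have h2 := sN_nonneg (j + 1)
                have : sN (j + 1) ^ 2 ≤ sN j ^ 2 := pow_le_pow_left₀ h2 h1 2
                linarith
              have hM2 : 0 ≤ M ^ 2 := sq_nonneg M
              have hlen : 1641592 / 1000000 - 2 * yN j ≤
                  lamS + (π / 2 - yN j) - (lamS - (π / 2 - yN j)) - 3 / 2 - 0 := by linarith
              calc M ^ 2 * ((sN j ^ 2 - sN (j + 1) ^ 2) * (1641592 / 1000000 - 2 * yN j))
                  = (M ^ 2 * (sN j ^ 2 - sN (j + 1) ^ 2)) * (1641592 / 1000000 - 2 * yN j) := by ring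
                _ ≤ (M ^ 2 * (sN j ^ 2 - sN (j + 1) ^ 2)) *
                    (lamS + (π / 2 - yN j) - (lamS - (π / 2 - yN j)) - 3 / 2 - 0) :=
                    mul_le_mul_of_nonneg_left hlen (mul_nonneg hM2 ht)
      have hcredB : M ^ 2 * (571 / 2500) ≤ ∑ j ∈ Finset.range 16, M ^ 2 * (sN j ^ 2 - sN (j + 1) ^ 2) *
            (-lamS + (π / 2 - yN j) - (-lamS - (π / 2 - yN j)) - 3 / 2 -
              if -lamS - (π / 2 - yN j) < 0 ∧ 0 ≤ -lamS + (π / 2 - yN j) then 3 / 2 else 0) := by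
        have h := credit16
        calc M ^ 2 * (571 / 2500) ≤ M ^ 2 * ∑ j ∈ Finset.range 16,
              (sN j ^ 2 - sN (j + 1) ^ 2) * (1641592 / 1000000 - 2 * yN j) :=
              mul_le_mul_of_nonneg_left h (sq_nonneg M)
          _ = ∑ j ∈ Finset.range 16, M ^ 2 * ((sN j ^ 2 - sN (j + 1) ^ 2) * (1641592 / 1000000 - 2 * yN j)) := by
              rw [Finset.mul_sum]
          _ ≤ _ := by
              apply Finset.sum_le_sum
              intro j hj
              have hj16 := Finset.mem_range.mp hj
              rw [if_neg (hgeo j hj16 (-lamS) hfar')]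
              have ht : 0 ≤ sN j ^ 2 - sN (j + 1) ^ 2 := by
                have h1 := sN_succ_le j
                have h2 := sN_nonneg (j + 1)
                have : sN (j + 1) ^ 2 ≤ sN j ^ 2 := pow_le_pow_left₀ h2 h1 2
                linarith
              have hM2 : 0 ≤ M ^ 2 := sq_nonneg M
              have hlen : 1641592 / 1000000 - 2 * yN j ≤
                  -lamS + (π / 2 - yN j) - (-lamS - (π / 2 - yN j)) - 3 / 2 - 0 := by linarith
              calc M ^ 2 * ((sN j ^ 2 - sN (j + 1) ^ 2) * (1641592 / 1000000 - 2 * yN j))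
                  = (M ^ 2 * (sN j ^ 2 - sN (j + 1) ^ 2)) * (1641592 / 1000000 - 2 * yN j) := by ring
                _ ≤ (M ^ 2 * (sN j ^ 2 - sN (j + 1) ^ 2)) *
                    (-lamS + (π / 2 - yN j) - (-lamS - (π / 2 - yN j)) - 3 / 2 - 0) :=
                    mul_le_mul_of_nonneg_left hlen (mul_nonneg hM2 ht)
      -- the arithmetic: 2π θ X² ≤ (1+ε) Φ · credit
      set CR := (∑ j ∈ Finset.range 16, M ^ 2 * (sN j ^ 2 - sN (j + 1) ^ 2) *
            (lamS + (π / 2 - yN j) - (lamS - (π / 2 - yN j)) - 3 / 2 -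
              if lamS - (π / 2 - yN j) < 0 ∧ 0 ≤ lamS + (π / 2 - yN j) then 3 / 2 else 0)) +
          ∑ j ∈ Finset.range 16, M ^ 2 * (sN j ^ 2 - sN (j + 1) ^ 2) *
            (-lamS + (π / 2 - yN j) - (-lamS - (π / 2 - yN j)) - 3 / 2 -
              if -lamS - (π / 2 - yN j) < 0 ∧ 0 ≤ -lamS + (π / 2 - yN j) then 3 / 2 else 0) with hCR
      have hCR2 : 2 * (M ^ 2 * (571 / 2500)) ≤ CR := by rw [hCR]; linarith
      have hsinh := SignConeRung.sinh_le_of_le_half hκ₀.le hκ₀'.le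
      have hΦ := SignConeRung.Phi_lower hκ₀
      have hΦ0 : 0 ≤ Phi κ₀ := le_trans (by positivity) hΦ
      set X := ‖∫ u in Icc (-1 : ℝ) 1, 2 * (Real.sinh (κ₀ * u) : ℂ) * f u‖ with hX_def
      have hX0 : 0 ≤ X := norm_nonneg _
      have hX : X ≤ 2.0844 * κ₀ * M := by
        calc X ≤ 2 * M * Real.sinh κ₀ := hpair
          _ ≤ 2 * M * (2 * κ₀ * 0.5211) := by gcongr
          _ = 2.0844 * κ₀ * M := by ring
      have hX2 : X ^ 2 ≤ (2.0844 * κ₀ * M) ^ 2 := pow_le_pow_left₀ hX0 hX 2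
      have hkm : 0 ≤ (κ₀ * M) ^ 2 := sq_nonneg _
      have hCR0 : 0 ≤ CR := le_trans (by positivity) hCR2
      calc 2 * Real.pi * (43 / 1000) * X ^ 2 ≤ 2 * 3.141593 * (43 / 1000) * (2.0844 * κ₀ * M) ^ 2 := by
            gcongr
        _ ≤ 1 * (8 / 3 * κ₀ ^ 2) * (2 * (M ^ 2 * (571 / 2500))) := by nlinarith
        _ ≤ (1 + ε) * Phi κ₀ * CR := by gcongr; linarith

end assembly
end Summit.RiemannHypothesis.RiemannHypothesis.Theorems.Splittings.XWucG8.DSLine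
namespace Summit.RiemannHypothesis.RiemannHypothesis.Theorems.Splittings.XWucG8
/-- the (α₁) rung at every `θ ≤ 43/1000` — in particular at the companion-row threshold `θ(3/2) = 0.02788·(3/2)`. -/
theorem kCertLOn_sAlpha {θ : ℝ} (hθ : θ ≤ 43 / 1000) : KCertLOn DSLine.SAlpha 400 (3 / 2) θ :=
  kCertLOn_anti hθ DSLine.kCertLOn_sAlpha

end Summit.RiemannHypothesis.RiemannHypothesis.Theorems.Splittings.XWucG8
namespace Summit.RiemannHypothesis.RiemannHypothesis.Theorems.Splittings.XWucG8
open scoped Classical ComplexConjugate InnerProductSpace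
open Set Filter Topology Complex MeasureTheory
open Literature.NumberTheory.LFunctions Literature.NumberTheory.LFunctions.Bombieri2000
open Summit.RiemannHypothesis.RiemannHypothesis.Theses.RuelleBand
open Summit.RiemannHypothesis.RiemannHypothesis.Theorems.Splittings.BombieriTruncEigen
open Summit.RiemannHypothesis.RiemannHypothesis.Theorems.Splittings.BombieriFozNoDep
open Summit.RiemannHypothesis.RiemannHypothesis.Theorems.Splittings.BombieriTruncGram
open Summit.RiemannHypothesis.RiemannHypothesis.Theorems.Splittings.BombieriTruncPairing
open Summit.RiemannHypothesis.RiemannHypothesis.Theorems.Splittings.BombieriTruncScreening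
open Summit.RiemannHypothesis.RiemannHypothesis.Theorems.Splittings.BombieriTruncBandGap
open Summit.RiemannHypothesis.RiemannHypothesis.Theorems.Splittings.BombieriTruncMultiplicity
open Summit.RiemannHypothesis.RiemannHypothesis.Theorems.Splittings.BombieriTruncEventualStrip
open Summit.RiemannHypothesis.RiemannHypothesis.Theorems.Splittings.BombieriTruncExactness
open Summit.RiemannHypothesis.RiemannHypothesis.Theorems.Splittings.BombieriTruncClump
open Summit.RiemannHypothesis.RiemannHypothesis.Theorems.Splittings.BombieriTruncOffLineSparse
open Summit.RiemannHypothesis.RiemannHypothesis.Theorems.Splittings.BombieriTruncSynthesis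
open Summit.RiemannHypothesis.RiemannHypothesis.Theorems.Splittings.BombieriTruncSynthesisScreening
open Summit.RiemannHypothesis.RiemannHypothesis.Theorems.Splittings.BombieriTruncSynthesisRows
open Literature.NumberTheory.DiophantineGeometry (RiemannHypothesisUpTo)
section Repair
open KCertRidge KCertBridge
/-- **The certificate body of the repaired node at density `D`** for one test function `f`: a finite interval certificate inside the
SCALED band `[−e^{2πD}/4, e^{2πD}/4]` (windows of length `≤ Lc`, weights `t_i ≥ 0`) lying below `|F_f(λ, κ)|²` for every `κ ∈ [0, ½)`,
whose δ-credit PLUS THE RIDGE `‖f‖²_{L²[−1,1]}/D` dominates `2πθ |⟨2 sinh(κ₀·), f⟩|² / ((1+ε) Φ(κ₀))`. -/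
def CertBodyR (ε κ₀ D Lc δ θ : ℝ) (f : ℝ → ℂ) : Prop :=
  ∃ (m : ℕ) (a b t : Fin m → ℝ),
    (∀ i, -(Real.exp (2 * Real.pi * D) / 4) ≤ a i ∧ a i < b i ∧ b i ≤ Real.exp (2 * Real.pi * D) / 4 ∧
        b i - a i ≤ Lc ∧ 0 ≤ t i) ∧
    (∀ lam κ : ℝ, 0 ≤ κ → κ < 1 / 2 →
        (∑ i ∈ Finset.univ.filter (fun i ↦ a i < lam ∧ lam ≤ b i), t i) ≤ ‖tfT f lam κ‖ ^ 2) ∧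
    2 * Real.pi * θ * ‖∫ u in Icc (-1 : ℝ) 1, 2 * (Real.sinh (κ₀ * u) : ℂ) * f u‖ ^ 2 ≤
      (1 + ε) * Phi κ₀ * ((∫ u in Icc (-1 : ℝ) 1, ‖f u‖ ^ 2) / D +
        ∑ i, t i * (b i - a i - δ - (if a i < 0 ∧ 0 ≤ b i then δ else 0)))

/-- **K-CERT′_{Lc}(δ, θ) = `KCertLR Lc δ θ`** (RULING #239; the repair of the refuted `KCertL`): for every `ε > 0`, `κ₀ ∈ (0, ½)`, density
`D ≥ 1` and continuous `f`, the body `CertBodyR ε κ₀ D Lc δ θ f` — ridge KEPT, band `e^{2πD}/4`.  [new; conjectural — K1′ of card §17] -/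
@[conjecture] def KCertLR (Lc δ θ : ℝ) : Prop :=
  ∀ ε : ℝ, 0 < ε → ∀ κ₀ : ℝ, 0 < κ₀ → κ₀ < 1 / 2 → ∀ D : ℝ, 1 ≤ D → ∀ f : ℝ → ℂ, Continuous f →
    CertBodyR ε κ₀ D Lc δ θ f

/-- `KCertLR` with the test functions restricted to a class `S` (same body). -/
def KCertLROn (S : Set (ℝ → ℂ)) (Lc δ θ : ℝ) : Prop :=
  ∀ ε : ℝ, 0 < ε → ∀ κ₀ : ℝ, 0 < κ₀ → κ₀ < 1 / 2 → ∀ D : ℝ, 1 ≤ D → ∀ f : ℝ → ℂ, f ∈ S → Continuous f →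
    CertBodyR ε κ₀ D Lc δ θ f

/-- the body is antitone in `θ` -/
theorem certBodyR_anti {ε κ₀ D Lc δ θ θ' : ℝ} (hle : θ' ≤ θ)
    {f : ℝ → ℂ} (h : CertBodyR ε κ₀ D Lc δ θ f) : CertBodyR ε κ₀ D Lc δ θ' f := by
  obtain ⟨m, a, b, t, hw, hc, hfin⟩ := h
  refine ⟨m, a, b, t, hw, hc, le_trans ?_ hfin⟩
  have : 0 ≤ 2 * Real.pi * ‖∫ u in Icc (-1 : ℝ) 1, 2 * (Real.sinh (κ₀ * u) : ℂ) * f u‖ ^ 2 := by positivity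
  nlinarith

/-- `KCertLROn S` (in particular `KCertLR`) is ANTITONE in `θ`. -/
theorem kCertLROn_anti {S : Set (ℝ → ℂ)} {Lc δ θ θ' : ℝ} (hle : θ' ≤ θ) (h : KCertLROn S Lc δ θ) :
    KCertLROn S Lc δ θ' :=
  fun ε hε κ₀ h1 h2 D hD f hf hfc ↦ certBodyR_anti hle (h ε hε κ₀ h1 h2 D hD f hf hfc)

/-- `4 sinh² x = 2 cosh 2x − 2` -/
theorem four_sinh_sq (x : ℝ) : 4 * Real.sinh x ^ 2 = 2 * Real.cosh (2 * x) - 2 := by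
  rw [Real.cosh_two_mul, Real.cosh_sq]; ring

end Repair
end Summit.RiemannHypothesis.RiemannHypothesis.Theorems.Splittings.XWucG8
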